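import Summits.RiemannHypothesis.RiemannHypothesis.Theorems.TiltedLandingLaw421R3Lens1ArcSignL

/-!
# TiltedLandingLaw421R3 — lens-1 (part M): the TONGUE SEAL typed; Cauchy–Riemann monotonicity along a nodal arc PROVED; SEAL ⇒ GAP ORDER

LENS-1 gen-7 module image `rh33346-cover/lens-1/TongueSeal-v1.lean` (landing target `…/Theorems/TiltedLandingLaw421R3Lens1ArcSignM.lean`; ONE import = part L
`…R3Lens1ArcSignL` = image `lens-1/AtomicGapOrder-v1.lean` ded7221aba373285 until it is tree; namespace `RhW08.Lens1ArcSign`; 0 `sorry`; checked BY CHAIN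
`lens-1/TongueSeal-v1-chain.lean` over the tree parts A–I + `…R3NestedSign`).  Director (CA689)(D) = SUMMON duty (O7-5).

WHY THIS FILE.  The one un-typed input of the atomic branch is C6ʼs TONGUE PROPOSITION (g37 §2.6): between two consecutive bad pieces of a small circle
`C = ∂D`, `D = ball (Re a) (Im a + δ)`, let `R` be the component of `{Im φ < 0} ∩ D` along the gap; IF (i) `closure R` meets `C` only along the gap and
(ii) no real zero of `f^{(j)}` lies on `∂R`, THEN walking `∂R ∖ gap` from `w₂ = γ(t₃)` (start of the later piece) back to `w₁ = γ(t₂)` (end of the earlier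
one) with `R` on the left, `Re φ` never increases (Cauchy–Riemann: the tangential derivative of `Re φ` is the normal derivative of `Im φ` INTO `R`, which is
`≤ 0` on a nodal line bounding `{Im φ < 0}`), so `hi = Re φ(w₁) ≤ Re φ(w₂) = lo` — GAP ORDER.  Mathlib has no nodal-set / connected-component machinery to
speak of `R`, so the proposition is typed here in PATH CURRENCY, which is exactly what the boundary walk produces and what an instrument traces:
★ `SealingPath f j a δ t₂ t₃` := a differentiable arc `σ : [0,1] → closedBall`, `σ 0 = γ t₃`, `σ 1 = γ t₂`, along which `f^{(j)} ≠ 0` ((ii)),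
`Im φ = 0` (nodal) and `Im φ ≤ 0` immediately to the LEFT (direction `i·σ′`; the tongue side); (i) is the statement that the walk from `w₂` ARRIVES at `w₁` (it exists
as a path in the closed disc ending there).  ★ `TongueSealQ` := on a legal frame, for a simple top zero with a simple atomic mate, outside finitely many radii
every CONSECUTIVE gap (no bad point between the pieces) has a sealing path; `TongueSealAllQ` := the same for all ordered pairs of pieces (what would give
part Kʼs all-pairs `ArcOrder`; recorded because the census verified all pairs, not claimed by the mechanism).

CONTENT. §1 (pure calculus, no frame) `deriv_nonpos_of_right_nonpos` (a function vanishing at `0`, `≤ 0` on `(0, ε₀)`, differentiable at `0`, has derivative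
`≤ 0`) and ★★ `re_antitoneOn_of_nodal_left` — CR-MONOTONICITY ALONG A NODAL ARC, PROVED: `φ` complex-differentiable at the points of a differentiable arc `σ`
on `[s₀,s₁]`, `Im φ ∘ σ = 0`, `Im φ ≤ 0` just left of `σ` ⇒ `Re φ ∘ σ` is antitone (`d/ds Re φ(σ) = Re(φ′σ′) = d/dε Im φ(σ + ε iσ′)|₀ ≤ 0`,
then the mean value theorem) · §2 `SealingPath`, `TongueSealQ`, `TongueSealAllQ` (OPEN, typed) · §3 ★★ `re_le_of_sealingPath` (a sealing path orders the two piece ends), ★★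
`atomicGapOrderLaw_of_tongueSeal : TongueSealQ → AtomicGapOrderLawQ`, `atomicOrderLaw_of_tongueSealAll : TongueSealAllQ → AtomicOrderLawQ` (the directorʼs
`atomicOrderLaw_of_tongueSeal`, at the strength the all-pairs law needs), and the corollaries down the ladder of parts J/K/L:
`TongueSealQ ⟹ AtomicGapOrderLawQ ⟹ AtomicNetLawQ ⟹ (RUNG 4) the law on the atomic class`; with `NonAtomicTopResidualQ`, `TopPinning`.

WHY IT MIGHT FAIL (the typed seal, not the reduction).  (ii) A TOOTH ON THE TONGUE BOUNDARY: if `R` reaches the real chord of `D` at a real zero `x₀` of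
`f^{(j)}`, the boundary walk passes a pole of `φ`; walked with `R` on the left the chord is traversed eastward and `Re φ ≈ m/(x − x₀)` jumps UPWARD there — no
sealing path with `f^{(j)} ≠ 0` exists and the monotonicity genuinely breaks at that point (gap order may still hold by compensation; census 0/247 360 with
teeth, g37).  (i) THE TONGUE REACHES A SECOND ARC of `C` (or escapes through the lower half of `D`): the walk from `w₂` ends on `C ∖ {w₁}` and orders the
wrong pair of values.  Both are exactly C6ʼs residue (i)/(ii); the (O7-4) falsifier (atomic rows with 0–3 teeth, all pairs) probes them.  `TongueSealQ` is
STRONGER than `AtomicGapOrderLawQ` (it may fail where gap order survives); the law of record for payment stays `AtomicGapOrderLawQ` (part L).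

HONEST LABEL: one calculus lemma + typing + reductions; `TongueSealQ`, every atomic law, `TopPinning`, 33346, 33347 OPEN; nothing here bears on the truth
of RH; RH is not proved; checked ≠ landed ≠ proved.
-/

noncomputable section

namespace RhW08.Lens1ArcSign

open Complex Set Metric Filter Topology
open scoped Real ComplexConjugate
open Literature.Topology.PlaneTopology Literature.Analysis.Complex
open Summit.RiemannHypothesis.RiemannHypothesis.Theorems.Splittings.JensenWindow
open RhIdea6.G17.W07C7 RhIdea6.G17.W07C7.Rev6 RhIdea6.G18.W07C8.Law421BirthS RhIdea6.G19.W07C11.Seam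
open RhIdea6.G20.W07C12.Frac RhIdea6.G20.W07C12.StColP RhW07.C12.FieldSplit RhIdea6.G21.W07C13.TentMax
open RhW07.C14.TwoSided RhW07.C14.Classes RhW07.C14.Lineage RhW07.C14.Booking
open RhW07.C13.Heredity RhIdea6.G22.W07C15pre.Injection RhW07.E3.Cell RhW07.E3.Lit
open RhW08.Round1 RhW08.StSwap RhW08.Round2 RhW08.QuadW RhW08.SealSwapQ RhW08.SealSwap RhW08.SuccB RhW08.SuccSplit
open RhW08.SuccTheft RhW08.Column RhW08.Hurwitz RhW08.ClusterQ RhW08.ClusterQM RhW08.NewtonDoor RhW08.NewtonDoorGenusOne RhW08.PurseP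
open RhW08.Lens1SignCut RhW08.Lens1Coverage RhW08.IsolatedTilt RhW08.Lens1Pinning RhW08.Lens1PinningIso

/-! ## §1 Cauchy–Riemann monotonicity along a nodal arc (pure calculus) -/

/-- A real function vanishing at `0`, non-positive on `(0, ε₀)` and differentiable at `0` has derivative `≤ 0` there. -/
theorem deriv_nonpos_of_right_nonpos {g : ℝ → ℝ} {g' ε₀ : ℝ} (hg : HasDerivAt g g' 0) (h0 : g 0 = 0) (hε₀ : 0 < ε₀)
    (hle : ∀ ε ∈ Ioo 0 ε₀, g ε ≤ 0) : g' ≤ 0 := by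
  refine le_of_tendsto hg.tendsto_slope_zero_right ?_
  filter_upwards [Ioo_mem_nhdsGT hε₀] with ε hε
  rw [zero_add, h0, sub_zero, smul_eq_mul]
  exact mul_nonpos_of_nonneg_of_nonpos (inv_nonneg.2 hε.1.le) (hle ε hε)

/-- `Im (φ′ · iσ′) = Re (φ′ σ′)`: the normal derivative of `Im φ` to the left of an arc is the tangential derivative of `Re φ` (Cauchy–Riemann). -/
theorem im_mul_I_mul (z w : ℂ) : (z * (I * w)).im = (z * w).re := by
  simp only [Complex.mul_im, Complex.mul_re, Complex.I_re, Complex.I_im]; ring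

/-- ★★ CR-MONOTONICITY ALONG A NODAL ARC.  Let `σ` be differentiable on `[s₀, s₁]` with derivative `σ′`, `φ` complex-differentiable at every `σ s`,
`Im φ (σ s) = 0` (a nodal arc of `Im φ`) and `Im φ ≤ 0` immediately to the LEFT of `σ` (at `σ s + ε·iσ′(s)`, small `ε > 0`).  Then `Re φ ∘ σ` is
non-increasing on `[s₀, s₁]`.  (Where `σ′ = 0` — corners of a piecewise-analytic nodal line, slowed down — both conditions are empty and the derivative of
`Re φ ∘ σ` vanishes; monotonicity is unaffected.) -/
theorem re_antitoneOn_of_nodal_left {φ : ℂ → ℂ} {σ σ' : ℝ → ℂ} {s₀ s₁ : ℝ}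
    (hφ : ∀ s ∈ Icc s₀ s₁, DifferentiableAt ℂ φ (σ s)) (hσ : ∀ s ∈ Icc s₀ s₁, HasDerivAt σ (σ' s) s)
    (hnodal : ∀ s ∈ Icc s₀ s₁, (φ (σ s)).im = 0)
    (hleft : ∀ s ∈ Icc s₀ s₁, ∃ ε₀ : ℝ, 0 < ε₀ ∧ ∀ ε ∈ Ioo (0 : ℝ) ε₀, (φ (σ s + (ε : ℂ) * (I * σ' s))).im ≤ 0) :
    AntitoneOn (fun s => (φ (σ s)).re) (Icc s₀ s₁) := by
  -- the derivative of `Re φ ∘ σ`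
  have hF : ∀ s ∈ Icc s₀ s₁, HasDerivAt (fun s => (φ (σ s)).re) ((deriv φ (σ s) * σ' s).re) s := by
    intro s hs
    have h1 : HasDerivAt (fun s => φ (σ s)) (deriv φ (σ s) * σ' s) s := (hφ s hs).hasDerivAt.comp s (hσ s hs)
    simpa only [Function.comp_def, Complex.reCLM_apply] using Complex.reCLM.hasFDerivAt.comp_hasDerivAt s h1
  -- its sign, from the one-sided condition
  have hsgn : ∀ s ∈ Icc s₀ s₁, (deriv φ (σ s) * σ' s).re ≤ 0 := by
    intro s hs
    obtain ⟨ε₀, hε₀, hle⟩ := hleft s hs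
    have hpath : HasDerivAt (fun ε : ℝ => σ s + (ε : ℂ) * (I * σ' s)) (I * σ' s) 0 := by
      simpa using ((Complex.ofRealCLM.hasDerivAt (x := (0 : ℝ))).mul_const (I * σ' s)).const_add (σ s)
    have hφ0 : HasDerivAt φ (deriv φ (σ s)) (σ s + ((0 : ℝ) : ℂ) * (I * σ' s)) := by
      simpa using (hφ s hs).hasDerivAt
    have hg : HasDerivAt (fun ε : ℝ => (φ (σ s + (ε : ℂ) * (I * σ' s))).im) ((deriv φ (σ s) * (I * σ' s)).im) 0 := by
      simpa [Function.comp_def] using Complex.imCLM.hasFDerivAt.comp_hasDerivAt (0 : ℝ) (hφ0.comp (0 : ℝ) hpath)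
    have key := deriv_nonpos_of_right_nonpos hg (by simpa using hnodal s hs) hε₀ hle
    rwa [im_mul_I_mul] at key
  refine antitoneOn_of_deriv_nonpos (convex_Icc s₀ s₁) (fun s hs => (hF s hs).continuousAt.continuousWithinAt)
    (fun s hs => (hF s (interior_subset hs)).differentiableAt.differentiableWithinAt) ?_
  intro s hs
  rw [(hF s (interior_subset hs)).deriv]
  exact hsgn s (interior_subset hs)

/-! ## §2 The tongue seal, typed in path currency -/

/-- ★ A SEALING PATH for the gap between a piece ending at `t₂` and a piece starting at `t₃` (radius excess `δ`): a differentiable arc in the CLOSED disc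
from `γ(t₃)` back to `γ(t₂)` along which `f^{(j)} ≠ 0` (C6ʼs (ii): no tooth on the tongue boundary), `Im φ = 0` (it runs in the nodal set) and `Im φ ≤ 0`
immediately to its LEFT (the negative tongue `R` is on the left of the walk `w₂ → w₁`; C6ʼs (i) = the walk arrives at `w₁`).  `φ = (f^{(j)})′/f^{(j)}`,
`γ = circleLoop (Re a) (Im a + δ)`. -/
def SealingPath (f : ℂ → ℂ) (j : ℕ) (a : ℂ) (δ t₂ t₃ : ℝ) : Prop :=
  ∃ σ σ' : ℝ → ℂ, σ 0 = circleLoop (a.re : ℂ) (a.im + δ) t₃ ∧ σ 1 = circleLoop (a.re : ℂ) (a.im + δ) t₂ ∧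
    ∀ s ∈ Icc (0 : ℝ) 1, HasDerivAt σ (σ' s) s ∧ σ s ∈ closedBall (a.re : ℂ) (a.im + δ) ∧ iteratedDeriv j f (σ s) ≠ 0 ∧
      (deriv (iteratedDeriv j f) (σ s) / iteratedDeriv j f (σ s)).im = 0 ∧
      ∃ ε₀ : ℝ, 0 < ε₀ ∧ ∀ ε ∈ Ioo (0 : ℝ) ε₀,
        (deriv (iteratedDeriv j f) (σ s + (ε : ℂ) * (I * σ' s)) / iteratedDeriv j f (σ s + (ε : ℂ) * (I * σ' s))).im ≤ 0

/-- ★ THE TONGUE SEAL (OPEN; C6 g37 §2.6 Proposition typed; SUMMON (O7-5)).  On a legal frame, for a simple top zero `a` with a simple ATOMIC mate `v`: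
outside finitely many radii, every pair of CONSECUTIVE bad pieces of the small circle (`Im φ ≤ 0` on the closed gap between them) is joined by a sealing
path.  WHY IT MIGHT FAIL: a tooth on the tongue boundary (the walk meets a pole of `φ` on the real chord; `Re φ` jumps upward there); the tongue reaching
a second arc of the circle (the walk from `w₂` does not return to `w₁`).  Census behind it: ORDER 0/5 845 violations incl. 0/247 360 tooth insertions (C6
g37), residue (i)/(ii) 174/174 + 75/75 (g38); unproved.  STRONGER than `AtomicGapOrderLawQ`. -/
def TongueSealQ : Prop :=
  ∀ (η : ℝ) (f : ℂ → ℂ) (x₀ s hmax R Hs : ℝ) (B : ℕ), EngineHyps5 2 η f x₀ s hmax R Hs B → ∀ (j : ℕ) (a v : ℂ),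
    iteratedDeriv j f a = 0 → 0 < a.im → NoTallerToucher f j a → Atomic f j a v →
    iteratedDeriv (j + 1) f a ≠ 0 → iteratedDeriv (j + 1) f v ≠ 0 → ∃ d0 > 0, ∃ E : Set ℝ, E.Finite ∧ ∀ δ ∈ Ioo 0 d0 \ E,
      ∀ t₁ t₂ t₃ t₄ : ℝ, BadPiece f j a δ t₁ t₂ → BadPiece f j a δ t₃ t₄ → t₂ ≤ t₃ →
        (∀ t ∈ Icc t₂ t₃, (arcPhi f j a δ t).im ≤ 0) → SealingPath f j a δ t₂ t₃

/-- The ALL-PAIRS tongue seal (OPEN; what part Kʼs all-pairs `ArcOrder` would need; the census verified all pairs, the mechanism speaks to consecutive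
gaps only — recorded, not advocated). -/
def TongueSealAllQ : Prop :=
  ∀ (η : ℝ) (f : ℂ → ℂ) (x₀ s hmax R Hs : ℝ) (B : ℕ), EngineHyps5 2 η f x₀ s hmax R Hs B → ∀ (j : ℕ) (a v : ℂ),
    iteratedDeriv j f a = 0 → 0 < a.im → NoTallerToucher f j a → Atomic f j a v →
    iteratedDeriv (j + 1) f a ≠ 0 → iteratedDeriv (j + 1) f v ≠ 0 → ∃ d0 > 0, ∃ E : Set ℝ, E.Finite ∧ ∀ δ ∈ Ioo 0 d0 \ E,
      ∀ t₁ t₂ t₃ t₄ : ℝ, BadPiece f j a δ t₁ t₂ → BadPiece f j a δ t₃ t₄ → t₂ ≤ t₃ → SealingPath f j a δ t₂ t₃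

/-- All-pairs seal ⇒ consecutive seal. -/
theorem tongueSeal_of_tongueSealAll (h : TongueSealAllQ) : TongueSealQ := by
  intro η f x₀ s hmax R Hs B hE j a v ha hapos hN hA hda hdv
  obtain ⟨d0, hd0, E, hEfin, hS⟩ := h η f x₀ s hmax R Hs B hE j a v ha hapos hN hA hda hdv
  exact ⟨d0, hd0, E, hEfin, fun δ hδ t₁ t₂ t₃ t₄ h₁ h₂ h23 _ => hS δ hδ t₁ t₂ t₃ t₄ h₁ h₂ h23⟩

/-! ## §3 Seal ⇒ order -/

/-- ★★ A sealing path orders the two piece ends: `Re φ(γ t₂) ≤ Re φ(γ t₃)` («hi ≤ lo»), by CR-monotonicity along the path. -/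
theorem re_le_of_sealingPath {f : ℂ → ℂ} {j : ℕ} {a : ℂ} {δ t₂ t₃ : ℝ} (hGd : Differentiable ℂ (iteratedDeriv j f))
    (h : SealingPath f j a δ t₂ t₃) : (arcPhi f j a δ t₂).re ≤ (arcPhi f j a δ t₃).re := by
  obtain ⟨σ, σ', h0, h1, hP⟩ := h
  have hanti := re_antitoneOn_of_nodal_left (φ := fun w => deriv (iteratedDeriv j f) w / iteratedDeriv j f w) (σ := σ) (σ' := σ')
    (s₀ := 0) (s₁ := 1) (fun s hs => (hGd.deriv.differentiableAt).div (hGd.differentiableAt) (hP s hs).2.2.1)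
    (fun s hs => (hP s hs).1) (fun s hs => (hP s hs).2.2.2.1) (fun s hs => (hP s hs).2.2.2.2)
  have h01 := hanti (left_mem_Icc.2 (zero_le_one' ℝ)) (right_mem_Icc.2 (zero_le_one' ℝ)) zero_le_one
  simp only at h01
  rw [h0, h1] at h01
  exact h01

/-- ★★ (O7-5) TONGUE SEAL ⇒ GAP ORDER at law level. -/
theorem atomicGapOrderLaw_of_tongueSeal (h : TongueSealQ) : AtomicGapOrderLawQ := by
  intro η f x₀ s hmax R Hs B hE j a v ha hapos hN hA hda hdv
  obtain ⟨d0, hd0, E, hEfin, hS⟩ := h η f x₀ s hmax R Hs B hE j a v ha hapos hN hA hda hdv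
  have hGd : Differentiable ℂ (iteratedDeriv j f) := differentiable_iteratedDeriv_of_entire (realEntireLt2_of_hyps hE).diff j
  exact ⟨d0, hd0, E, hEfin, fun δ hδ t₁ t₂ t₃ t₄ h₁ h₂ h23 hgap => re_le_of_sealingPath hGd (hS δ hδ t₁ t₂ t₃ t₄ h₁ h₂ h23 hgap)⟩

/-- The directorʼs `atomicOrderLaw_of_tongueSeal`, at the strength all-pairs ORDER needs: ALL-PAIRS SEAL ⇒ ORDER. -/
theorem atomicOrderLaw_of_tongueSealAll (h : TongueSealAllQ) : AtomicOrderLawQ := by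
  intro η f x₀ s hmax R Hs B hE j a v ha hapos hN hA hda hdv
  obtain ⟨d0, hd0, E, hEfin, hS⟩ := h η f x₀ s hmax R Hs B hE j a v ha hapos hN hA hda hdv
  have hGd : Differentiable ℂ (iteratedDeriv j f) := differentiable_iteratedDeriv_of_entire (realEntireLt2_of_hyps hE).diff j
  exact ⟨d0, hd0, E, hEfin, fun δ hδ t₁ t₂ t₃ t₄ h₁ h₂ h23 => re_le_of_sealingPath hGd (hS δ hδ t₁ t₂ t₃ t₄ h₁ h₂ h23)⟩

/-- Down the ladder (parts L, J): TONGUE SEAL ⇒ the atomic NET law. -/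
theorem atomicNetLaw_of_tongueSeal (h : TongueSealQ) : AtomicNetLawQ :=
  atomicNetLaw_of_gapOrderLaw (atomicGapOrderLaw_of_tongueSeal h)

/-- TONGUE SEAL on atomic tops + the non-atomic residual ⇒ the residual statement of part I … -/
theorem topPinningResidual_of_tongueSealSplit (h : TongueSealQ) (hR : NonAtomicTopResidualQ) : TopPinningNonNestedAscResidual :=
  topPinningResidual_of_gapOrderSplit (atomicGapOrderLaw_of_tongueSeal h) hR

/-- … and `TopPinning`. -/
theorem topPinning_of_tongueSealSplit (h : TongueSealQ) (hR : NonAtomicTopResidualQ) : TopPinning :=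
  topPinning_of_nonNestedAscResidual (topPinningResidual_of_tongueSealSplit h hR)

end RhW08.Lens1ArcSign
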